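import Summits.Ventures.YMGap.RobustBall.BoundaryFreeEnergy
import Summits.Ventures.YMGap.RobustBall.PeriodisedBox
import Summits.Ventures.YMGap.RobustBall.ThermodynamicVariance
import HarnessLib

/-!
# Venture YMGap, track ROBUST-BALL — «C-DS-I» ON BOXES: the free energy of the cube `[−M, M]⁴` of `ℤ⁴` with an arbitrary boundary field,
# `SU(2)` Wilson at every `0 ≤ β_W ≤ 9/25`, with the explicit depth `M − ‖base(p)‖_∞`

HONEST FRAMING. WHAT THIS IS: a venture file (cell `pub-ymgap`, track Y2 ROBUST-BALL / DS, seat ds-3, theorems only, 0 compute): the cube cell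
of `BoundaryFreeEnergy.su2_abs_log_normaliser_sub_freeEnergy_le` («C-DS-I», rows 3b‴/T14B) with the canonical depth profile `φ(x) = M + 1 − ‖x‖_∞` of
the link volume `Λ_M = boxLinks 4 M` (links based in `[−M, M]⁴`), so that no depth data has to be supplied:
* `norm_fst_le_of_mem_plaquetteEdges` — the links of a plaquette are based within sup-distance `1` of its base point;
* ★★ `su2_abs_log_normaliser_box_sub_freeEnergy_le` — `SU(2)`, `d = 4`, tree coupling `0 ≤ b ≤ 9/50`, EVERY `M`, EVERY boundary field `η`:
  `|log Z_{Λ_M}(b|η) − (#T(Λ_M)/6)·f(b)| ≤ b · Σ_{p ∈ T(Λ_M)} min 4 (1024√2 · exp(−κ₁(R_G(2b)) · ⌊(M − ‖base p‖_∞)/4⌋))` — the summand is `4` only in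
  the boundary layer and decays exponentially with the depth `M − ‖base p‖_∞` of the plaquette: a SURFACE term, uniformly in `η`.
* ★★ `su2_abs_kernel_energy_sub_le` — the derivative form: the mean energy `γ_Λ^b(S_Λ|η)` with ANY boundary field equals `Σ_{p∈T(Λ)}(2 − μ(Re tr U_p))`
  (infinite-volume means) up to the same boundary-uniform surface sum, every finite `Λ`.
* ★★★ `su2_abs_log_normaliser_box_div_sub_le` — THE FREE ENERGY PER PLAQUETTE WITH AN ARBITRARY BOUNDARY FIELD CONVERGES TO `f(b)/6` UNIFORMLY IN
  THE BOUNDARY FIELD, with the explicit rate `b·(1024√2·e^{−κ₁K} + 4((2M+3)⁴ − (2(M−4K)+1)⁴)/(2M+1)⁴)` for every `4K ≤ M` (deep plaquettes pay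
  `e^{−κ₁K}`, the shallow layer its volume fraction; `#T(Λ_M) ≥ 6(2M+1)⁴`, `T(Λ_M) ⊆ siteBox(M+1) × planes`) — van Hove's theorem with
  arbitrary boundary conditions, quantitative and boundary-uniform on the whole window.
WHAT THIS IS NOT: lattice strong coupling; nothing continuum / Clay. Everything here is proved. [folklore]
-/

noncomputable section

open MeasureTheory ProbabilityTheory Filter Topology Real Finset Set
open scoped NNReal
open Literature.Probability.LatticeModels hiding configShift configShift_apply
open Literature.MathematicalPhysics.QuantumLattice
open Literature.MathematicalPhysics.QuantumFieldTheory (haarProbability)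
open Summit.Ventures.YMGap.StarWindowGauge (gaugeR gaugeR_lt_one_of_le)
open Summit.Ventures.YMGap.StarLemmaG (gaugeR_nonneg)

namespace Summit.Ventures.YMGap.RobustBall

namespace BoundaryFreeEnergy

/-- The links of the plaquette `p` are based within sup-distance `1` of its base point: `‖x.1‖ ≤ ‖p.1‖ + 1`. [folklore] -/
theorem norm_fst_le_of_mem_plaquetteEdges {d : ℕ} {p : ZdPlaquette d} {x : ZdEdge d} (hx : x ∈ plaquetteEdges p) :
    ‖x.1‖ ≤ ‖p.1‖ + 1 := by
  simp only [plaquetteEdges, Finset.mem_insert, Finset.mem_singleton] at hx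
  have h1 : ∀ k : Fin d, ‖p.1 + Pi.single k (1 : ℤ)‖ ≤ ‖p.1‖ + 1 := fun k =>
    (norm_add_le _ _).trans (by rw [Pi.norm_single]; simp)
  have h0 : ‖p.1‖ ≤ ‖p.1‖ + 1 := by linarith
  rcases hx with rfl | rfl | rfl | rfl
  · exact h0
  · exact h1 _
  · exact h1 _
  · exact h0

/-- A lattice vector of sup-norm `< M + 1` lies in the box `[−M, M]^d`. [folklore] -/
theorem mem_siteBox_of_norm_lt {d M : ℕ} {y : Site d} (hy : ‖y‖ < (M : ℝ) + 1) : y ∈ siteBox d M := by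
  rw [mem_siteBox]
  intro i
  have h1 : ‖y i‖ ≤ ‖y‖ := norm_le_pi_norm y i
  have h2 : |((y i : ℤ) : ℝ)| < M + 1 := by
    rw [← Int.norm_cast_real, ← Int.norm_eq_abs] at *
    have : ‖((y i : ℤ) : ℝ)‖ = ‖y i‖ := by rw [Int.norm_cast_real]
    linarith
  have h3 : |y i| < (M : ℤ) + 1 := by
    have : ((|y i| : ℤ) : ℝ) < (M : ℝ) + 1 := by rw [Int.cast_abs]; exact h2
    exact_mod_cast this
  omega

/-- ★★ **«C-DS-I» ON THE CUBES OF `ℤ⁴`** (`SU(2)`, `d = 4`, Wilson action, tree coupling `0 ≤ b ≤ 9/50`, i.e. EVERY `0 ≤ β_W ≤ 9/25`): for every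
`M` and EVERY boundary field `η` on the link volume `Λ_M = boxLinks 4 M`,
`|log Z_{Λ_M}(b|η) − (#T(Λ_M)/6)·f(b)| ≤ b · Σ_{p ∈ T(Λ_M)} min 4 (1024√2 · exp(−starRate 4 (R_G(2b)) · ⌊(M − ‖p.1‖)/4⌋))`. [folklore] -/
theorem su2_abs_log_normaliser_box_sub_freeEnergy_le {b : ℝ} (hb0 : 0 ≤ b) (hb : b ≤ 9 / 50) (M : ℕ)
    (η : LGConfig 4 (SUN 2)) :
    |Real.log (∫ ζ, Real.exp (-b * wilsonBoundaryAction (fundamentalRep (Fin 2)) (boxLinks 4 M) (glueWith (boxLinks 4 M) ζ η))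
          ∂(Measure.pi fun _ : ↥(boxLinks 4 M) => haarProbability (SUN 2))) -
        (plaquettesTouching (boxLinks 4 M)).card / 6 * freeEnergyDensity 4 (fundamentalRep (Fin 2)) b| ≤
      b * ∑ p ∈ plaquettesTouching (boxLinks 4 M),
        min 4 (1024 * Real.sqrt 2 * Real.exp (-(starRate 4 (gaugeR (2 * b)) * ⌊((M : ℝ) - ‖p.1‖) / (4 : ℕ)⌋₊))) := by
  refine su2_abs_log_normaliser_sub_freeEnergy_le hb0 hb (boxLinks 4 M) η (fun x => (M : ℝ) + 1 - ‖x.1‖)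
    (fun x y => ?_) (fun x hx => ?_) (fun p => (M : ℝ) - ‖p.1‖) (fun p _ x hx => ?_)
  · -- `1`-Lipschitz depth
    have h := norm_le_norm_add_norm_sub' y.1 x.1
    rw [norm_sub_rev] at h
    linarith
  · -- positive depth ⇒ inside the volume
    rw [mem_boxLinks]
    exact mem_siteBox_of_norm_lt (by linarith)
  · -- the links of `p` have depth at least `M − ‖p.1‖`
    have h := norm_fst_le_of_mem_plaquetteEdges hx
    linarith

/-- ★★ **THE ENERGY OF A FINITE REGION WITH AN ARBITRARY BOUNDARY FIELD IS THE VOLUME TERM PLUS A SURFACE TERM** (`SU(2)`, `d = 4`, tree coupling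
`0 ≤ b ≤ 9/50`): for every finite `Λ`, EVERY boundary field `η`, every DLR state `μ` at `b`, every depth profile `φ` of `Λ` and depths `m_p ≤ φ` on
the links of the plaquettes touching `Λ`:
`|γ_Λ^b(S_Λ|η) − Σ_{p∈T(Λ)} (2 − μ(Re tr U_p))| ≤ Σ_{p∈T(Λ)} min 4 (1024√2 · exp(−κ₁(R_G(2b)) ⌊m_p/4⌋))` — the mean energy with boundary
condition equals the infinite-volume mean energy of the same plaquettes up to a boundary-uniform surface term (the derivative form of «C-DS-I»).
[folklore] -/
theorem su2_abs_kernel_energy_sub_le {b : ℝ} (hb0 : 0 ≤ b) (hb : b ≤ 9 / 50)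
    {μ : Measure (LGConfig 4 (SUN 2))} (hμ : μ ∈ ymGibbsMeasures (d := 4) (fundamentalRep (Fin 2)) b)
    (Λ : Finset (ZdEdge 4)) (η : LGConfig 4 (SUN 2)) (φ : ZdEdge 4 → ℝ)
    (hφ : ∀ x y : ZdEdge 4, φ x ≤ φ y + ‖x.1 - y.1‖) (hφΛ : ∀ x, 0 < φ x → x ∈ Λ)
    (m : ZdPlaquette 4 → ℝ) (hm : ∀ p ∈ plaquettesTouching Λ, ∀ x ∈ plaquetteEdges p, m p ≤ φ x) :
    |(∫ U, wilsonBoundaryAction (fundamentalRep (Fin 2)) Λ U ∂(ymSpecification (d := 4) (fundamentalRep (Fin 2)) b Λ η)) -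
        ∑ p ∈ plaquettesTouching Λ, ((2 : ℝ) - ∫ U, plaquetteObs (fundamentalRep (Fin 2)) p.1 p.2.1.1 p.2.1.2 U ∂μ)| ≤
      ∑ p ∈ plaquettesTouching Λ,
        min 4 (1024 * Real.sqrt 2 * Real.exp (-(starRate 4 (gaugeR (2 * b)) * ⌊m p / (4 : ℕ)⌋₊))) := by
  rw [su2_integral_wilsonBoundaryAction_kernel, ← Finset.sum_sub_distrib]
  refine (Finset.abs_sum_le_sum_abs _ _).trans (Finset.sum_le_sum fun p hp => ?_)
  rw [show ∀ x y : ℝ, ((2 : ℝ) - x) - (2 - y) = -(x - y) from fun x y => by ring, abs_neg]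
  exact su2_abs_kernel_plaquette_sub_le hb0 le_rfl hb hμ Λ η φ hφ hφΛ p (hm p hp)

/-! ### Counting: the plaquettes touching the cube, and the shallow ones -/

/-- The base point of a plaquette is within sup-distance `1` of each of its links: `‖p.1‖ ≤ ‖x.1‖ + 1`. [folklore] -/
theorem norm_fst_le_norm_add_one_of_mem_plaquetteEdges {d : ℕ} {p : ZdPlaquette d} {x : ZdEdge d} (hx : x ∈ plaquetteEdges p) :
    ‖p.1‖ ≤ ‖x.1‖ + 1 := by
  simp only [plaquetteEdges, Finset.mem_insert, Finset.mem_singleton] at hx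
  have h1 : ∀ k : Fin d, ‖p.1‖ ≤ ‖p.1 + Pi.single k (1 : ℤ)‖ + 1 := fun k => by
    have h := norm_le_norm_add_norm_sub' (p.1) (p.1 + Pi.single k (1 : ℤ))
    rw [show p.1 - (p.1 + Pi.single k (1 : ℤ)) = -Pi.single k 1 by abel, norm_neg, Pi.norm_single] at h
    simpa using h
  rcases hx with rfl | rfl | rfl | rfl
  · simp
  · exact h1 _
  · exact h1 _
  · simp

/-- **Every plaquette based in the cube touches the cube's links**: `siteBox 4 M × planes ⊆ T(Λ_M)`; hence `#T(Λ_M) ≥ 6(2M+1)⁴`. [folklore] -/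
theorem siteBox_product_subset_plaquettesTouching (M : ℕ) :
    (siteBox 4 M) ×ˢ (Finset.univ : Finset {q : Fin 4 × Fin 4 // q.1 < q.2}) ⊆ plaquettesTouching (boxLinks 4 M) := by
  intro p hp
  rw [Finset.mem_product] at hp
  rw [mem_plaquettesTouching_iff]
  refine ⟨(p.1, p.2.1.1), Finset.mem_inter.2 ⟨by simp [plaquetteEdges], ?_⟩⟩
  rw [mem_boxLinks]; exact hp.1

/-- **Every plaquette touching the cube's links is based in the cube of radius `M + 1`**: `T(Λ_M) ⊆ siteBox 4 (M+1) × planes`; hence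
`#T(Λ_M) ≤ 6(2M+3)⁴`. [folklore] -/
theorem plaquettesTouching_boxLinks_subset (M : ℕ) :
    plaquettesTouching (boxLinks 4 M) ⊆ (siteBox 4 (M + 1)) ×ˢ (Finset.univ : Finset {q : Fin 4 × Fin 4 // q.1 < q.2}) := by
  intro p hp
  rw [mem_plaquettesTouching_iff] at hp
  obtain ⟨x, hx⟩ := hp
  obtain ⟨hxp, hxΛ⟩ := Finset.mem_inter.1 hx
  rw [mem_boxLinks, mem_siteBox_iff_norm] at hxΛ
  rw [Finset.mem_product]
  refine ⟨mem_siteBox_of_norm_lt ?_, Finset.mem_univ _⟩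
  have h := norm_fst_le_norm_add_one_of_mem_plaquetteEdges hxp
  push_cast; linarith

/-- **The shallow plaquettes** (base point farther than `M − 4K` from the origin) number at most `6·((2M+3)⁴ − (2(M−4K)+1)⁴)`, `4K ≤ M`.
[folklore] -/
theorem card_shallow_le {M K : ℕ} (hK : 4 * K ≤ M) :
    (((plaquettesTouching (boxLinks 4 M)).filter fun p => ((M : ℝ) - 4 * K) < ‖p.1‖).card : ℝ) ≤
      6 * ((2 * (M : ℝ) + 3) ^ 4 - (2 * ((M : ℝ) - 4 * K) + 1) ^ 4) := by
  classical
  have hsub : ((plaquettesTouching (boxLinks 4 M)).filter fun p => ((M : ℝ) - 4 * K) < ‖p.1‖) ⊆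
      (siteBox 4 (M + 1) \ siteBox 4 (M - 4 * K)) ×ˢ (Finset.univ : Finset {q : Fin 4 × Fin 4 // q.1 < q.2}) := by
    intro p hp
    obtain ⟨hpT, hpn⟩ := Finset.mem_filter.1 hp
    have h1 := Finset.mem_product.1 (plaquettesTouching_boxLinks_subset M hpT)
    rw [Finset.mem_product, Finset.mem_sdiff]
    refine ⟨⟨h1.1, fun h2 => ?_⟩, Finset.mem_univ _⟩
    rw [mem_siteBox_iff_norm, Nat.cast_sub hK] at h2
    push_cast at h2
    linarith
  have hcard := Finset.card_le_card hsub
  rw [Finset.card_product, Finset.card_sdiff_of_subset (ThermodynamicVariance.siteBox_mono (by omega)),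
    ThermodynamicVariance.card_siteBox, ThermodynamicVariance.card_siteBox, Finset.card_univ,
    show Fintype.card {q : Fin 4 × Fin 4 // q.1 < q.2} = 6 from by decide] at hcard
  have hpow : (2 * (M - 4 * K) + 1) ^ 4 ≤ (2 * (M + 1) + 1) ^ 4 := Nat.pow_le_pow_left (by omega) 4
  have h : ((((2 * (M + 1) + 1) ^ 4 - (2 * (M - 4 * K) + 1) ^ 4) * 6 : ℕ) : ℝ) =
      6 * ((2 * (M : ℝ) + 3) ^ 4 - (2 * ((M : ℝ) - 4 * K) + 1) ^ 4) := by
    rw [Nat.cast_mul, Nat.cast_sub hpow]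
    push_cast
    rw [Nat.cast_sub hK]
    push_cast
    ring
  rw [← h]
  exact_mod_cast hcard

/-- ★★★ **THE FREE ENERGY PER PLAQUETTE OF A CUBE WITH AN ARBITRARY BOUNDARY FIELD CONVERGES TO `f(b)/6`, UNIFORMLY IN THE BOUNDARY FIELD,
WITH AN EXPLICIT RATE** (`SU(2)`, `d = 4`, tree coupling `0 ≤ b ≤ 9/50`): for every `M`, every `K` with `4K ≤ M` and EVERY boundary field `η`,
`|log Z_{Λ_M}(b|η)/#T(Λ_M) − f(b)/6| ≤ b·(1024√2·exp(−κ₁(R_G(2b))·K) + 4·((2M+3)⁴ − (2(M−4K)+1)⁴)/(2M+1)⁴)`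
— deep plaquettes (depth `≥ 4K`) pay `e^{−κ₁ K}`, the shallow layer pays its volume fraction; with `K = ⌊√M⌋` the right side is
`O(b(e^{−κ₁√M} + √M/M)) → 0`. [folklore] -/
theorem su2_abs_log_normaliser_box_div_sub_le {b : ℝ} (hb0 : 0 ≤ b) (hb : b ≤ 9 / 50) {M K : ℕ} (hK : 4 * K ≤ M)
    (η : LGConfig 4 (SUN 2)) :
    |Real.log (∫ ζ, Real.exp (-b * wilsonBoundaryAction (fundamentalRep (Fin 2)) (boxLinks 4 M) (glueWith (boxLinks 4 M) ζ η))
          ∂(Measure.pi fun _ : ↥(boxLinks 4 M) => haarProbability (SUN 2))) / (plaquettesTouching (boxLinks 4 M)).card -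
        freeEnergyDensity 4 (fundamentalRep (Fin 2)) b / 6| ≤
      b * (1024 * Real.sqrt 2 * Real.exp (-(starRate 4 (gaugeR (2 * b)) * K)) +
        4 * (((2 * (M : ℝ) + 3) ^ 4 - (2 * ((M : ℝ) - 4 * K) + 1) ^ 4) / (2 * (M : ℝ) + 1) ^ 4)) := by
  classical
  set T := plaquettesTouching (boxLinks 4 M) with hT
  set κ : ℝ := starRate 4 (gaugeR (2 * b)) with hκ
  set C : ℝ := 1024 * Real.sqrt 2 with hC
  have hC0 : 0 ≤ C := by positivity
  -- the volume: `6(2M+1)⁴ ≤ #T`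
  have hTge : 6 * (2 * (M : ℝ) + 1) ^ 4 ≤ (T.card : ℝ) := by
    have h := Finset.card_le_card (siteBox_product_subset_plaquettesTouching M)
    rw [Finset.card_product, ThermodynamicVariance.card_siteBox, Finset.card_univ,
      show Fintype.card {q : Fin 4 × Fin 4 // q.1 < q.2} = 6 from by decide] at h
    have h' : (((2 * M + 1) ^ 4 * 6 : ℕ) : ℝ) ≤ (T.card : ℝ) := by exact_mod_cast h
    push_cast at h'
    linarith
  have hV0 : (0 : ℝ) < 6 * (2 * (M : ℝ) + 1) ^ 4 := by positivity
  have hTpos : (0 : ℝ) < (T.card : ℝ) := hV0.trans_le hTge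
  -- the surface sum, split into deep and shallow plaquettes
  have hmain := su2_abs_log_normaliser_box_sub_freeEnergy_le hb0 hb M η
  set g : ZdPlaquette 4 → ℝ := fun p => min 4 (C * Real.exp (-(κ * ⌊((M : ℝ) - ‖p.1‖) / (4 : ℕ)⌋₊))) with hg
  have hg0 : ∀ p, 0 ≤ g p := fun p => le_min (by norm_num) (by positivity)
  have hsplit : ∑ p ∈ T, g p ≤ C * Real.exp (-(κ * K)) * T.card +
      4 * (6 * ((2 * (M : ℝ) + 3) ^ 4 - (2 * ((M : ℝ) - 4 * K) + 1) ^ 4)) := by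
    rw [← Finset.sum_filter_add_sum_filter_not T (fun p => ((M : ℝ) - 4 * K) < ‖p.1‖)]
    have hκ0 : 0 ≤ κ := (starRate_pos (gaugeR_nonneg (by linarith) (by linarith))
      (gaugeR_lt_one_of_le (by linarith) (by linarith))).le
    -- shallow: each term ≤ 4
    have hsh : ∑ p ∈ T.filter (fun p => ((M : ℝ) - 4 * K) < ‖p.1‖), g p ≤
        4 * (6 * ((2 * (M : ℝ) + 3) ^ 4 - (2 * ((M : ℝ) - 4 * K) + 1) ^ 4)) := by
      refine (Finset.sum_le_card_nsmul _ _ 4 fun p _ => min_le_left _ _).trans ?_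
      rw [nsmul_eq_mul, mul_comm]
      exact mul_le_mul_of_nonneg_left (card_shallow_le hK) (by norm_num)
    -- deep: depth `≥ 4K` ⇒ term `≤ C e^{−κK}`
    have hdp : ∑ p ∈ T.filter (fun p => ¬((M : ℝ) - 4 * K) < ‖p.1‖), g p ≤ C * Real.exp (-(κ * K)) * T.card := by
      refine (Finset.sum_le_card_nsmul _ _ (C * Real.exp (-(κ * K))) fun p hp => ?_).trans ?_
      · have hpK : (K : ℝ) ≤ ⌊((M : ℝ) - ‖p.1‖) / (4 : ℕ)⌋₊ := by
          have h1 : ‖p.1‖ ≤ (M : ℝ) - 4 * K := not_lt.1 (Finset.mem_filter.1 hp).2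
          have h2 : (K : ℝ) ≤ ((M : ℝ) - ‖p.1‖) / (4 : ℕ) := by
            rw [le_div_iff₀ (by norm_num)]; push_cast; linarith
          exact_mod_cast (Nat.le_floor h2 : K ≤ ⌊((M : ℝ) - ‖p.1‖) / (4 : ℕ)⌋₊)
        refine (min_le_right _ _).trans (mul_le_mul_of_nonneg_left (Real.exp_le_exp.2 ?_) hC0)
        nlinarith
      · rw [nsmul_eq_mul]
        have hc : ((T.filter (fun p => ¬((M : ℝ) - 4 * K) < ‖p.1‖)).card : ℝ) ≤ T.card := by
          exact_mod_cast Finset.card_filter_le _ _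
        have : 0 ≤ C * Real.exp (-(κ * K)) := by positivity
        nlinarith
    linarith
  -- divide by `#T`
  have hkey : |Real.log (∫ ζ, Real.exp (-b * wilsonBoundaryAction (fundamentalRep (Fin 2)) (boxLinks 4 M)
        (glueWith (boxLinks 4 M) ζ η)) ∂(Measure.pi fun _ : ↥(boxLinks 4 M) => haarProbability (SUN 2))) -
      (T.card : ℝ) / 6 * freeEnergyDensity 4 (fundamentalRep (Fin 2)) b| ≤ b * ∑ p ∈ T, g p := hmain
  rw [show Real.log (∫ ζ, Real.exp (-b * wilsonBoundaryAction (fundamentalRep (Fin 2)) (boxLinks 4 M)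
        (glueWith (boxLinks 4 M) ζ η)) ∂(Measure.pi fun _ : ↥(boxLinks 4 M) => haarProbability (SUN 2))) / (T.card : ℝ) -
      freeEnergyDensity 4 (fundamentalRep (Fin 2)) b / 6 =
      (Real.log (∫ ζ, Real.exp (-b * wilsonBoundaryAction (fundamentalRep (Fin 2)) (boxLinks 4 M)
        (glueWith (boxLinks 4 M) ζ η)) ∂(Measure.pi fun _ : ↥(boxLinks 4 M) => haarProbability (SUN 2))) -
      (T.card : ℝ) / 6 * freeEnergyDensity 4 (fundamentalRep (Fin 2)) b) / (T.card : ℝ) by field_simp, abs_div,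
    abs_of_pos hTpos, div_le_iff₀ hTpos]
  refine hkey.trans ?_
  have hfrac : 4 * (6 * ((2 * (M : ℝ) + 3) ^ 4 - (2 * ((M : ℝ) - 4 * K) + 1) ^ 4)) ≤
      4 * (((2 * (M : ℝ) + 3) ^ 4 - (2 * ((M : ℝ) - 4 * K) + 1) ^ 4) / (2 * (M : ℝ) + 1) ^ 4) * T.card := by
    have hnn : 0 ≤ (2 * (M : ℝ) + 3) ^ 4 - (2 * ((M : ℝ) - 4 * K) + 1) ^ 4 := by
      have h1 : (2 * ((M : ℝ) - 4 * K) + 1) ≤ 2 * (M : ℝ) + 3 := by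
        have : (0 : ℝ) ≤ K := Nat.cast_nonneg K
        linarith
      have h0 : 0 ≤ 2 * ((M : ℝ) - 4 * K) + 1 := by
        have : (4 * K : ℝ) ≤ M := by exact_mod_cast hK
        linarith
      nlinarith [pow_le_pow_left₀ h0 h1 4]
    rw [← mul_div_assoc, div_mul_eq_mul_div, le_div_iff₀ (by positivity)]
    nlinarith [hTge, hnn]
  calc b * ∑ p ∈ T, g p ≤ b * (C * Real.exp (-(κ * K)) * T.card + 4 * (6 * ((2 * (M : ℝ) + 3) ^ 4 - (2 * ((M : ℝ) - 4 * K) + 1) ^ 4))) :=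
        mul_le_mul_of_nonneg_left hsplit hb0
    _ ≤ b * (C * Real.exp (-(κ * K)) * T.card +
        4 * (((2 * (M : ℝ) + 3) ^ 4 - (2 * ((M : ℝ) - 4 * K) + 1) ^ 4) / (2 * (M : ℝ) + 1) ^ 4) * T.card) := by
        gcongr
    _ = b * (C * Real.exp (-(κ * K)) + 4 * (((2 * (M : ℝ) + 3) ^ 4 - (2 * ((M : ℝ) - 4 * K) + 1) ^ 4) / (2 * (M : ℝ) + 1) ^ 4)) *
        (T.card : ℝ) := by ring

end BoundaryFreeEnergy

end Summit.Ventures.YMGap.RobustBall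

end
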